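import Summits.HubbardSuperconductivity.HubbardSuperconductivity.Theorems.AnisotropyChordFerroSideLambdaContinuity
import Summits.HubbardSuperconductivity.HubbardSuperconductivity.Theses.AnisotropyChord

/-!
# Route `AnisotropyChord`, crux `FerroSideChord` (stmt-HubbardSuperconductivity-19089):
# piece C of its range split — `FerroSideChordEndpoints` (stmt-HubbardSuperconductivity-23920)

Notation of the route: `H_M(Δ) = xxzHamiltonian 1 (torusGraph 2 M) (-1) Δ` (`= hcbHamiltonian M Δ`),
sector `S^z_tot = 0`, `Λ(ψ) = Re⟨ψ, S⁺_tot S⁻_tot ψ⟩`, `S(S+1) := (M²/2)(M²/2+1)`.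

* `chord_le_lambda_of_interior` — if the chord bound `((1+Δ)/2)·S(S+1) ≤ Λ(ψ)` holds for every
  `Δ ∈ (0,1)` and every normalised sector ground state, then it holds at every `Δ₀` that has points
  of `(0,1)` arbitrarily close, for every normalised sector ground state of `H_M(Δ₀)`: `Λ` is
  continuous in `Δ` across sector ground states (`FerroSide.sectorGS_lambda_continuousAt`, Perron
  uniqueness + a gap estimate), the chord is affine in `Δ`, and `≤` is closed;
* **`ferroSideChordEndpoints_proof : FerroSideChordEndpoints`** — the route item verbatim
  (`Δ₀ ∈ {0, 1}`; no use of `FerroPointValue`).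

Elementary (T. Kato, *Perturbation Theory for Linear Operators* (1966) II-§5.1, finite-dimensional;
H. Tasaki (2020) §2.2).  No definition is introduced.
-/

set_option linter.dupNamespace false

noncomputable section

open Matrix Complex Finset Filter Topology
open scoped ComplexConjugate
open Literature.MathematicalPhysics.QuantumLattice hiding torusPhase torusNorm
open Literature.Probability.LatticeModels
open Summit.HubbardSuperconductivity.HubbardSuperconductivity.Theses.AnisotropyChord
open Summit.HubbardSuperconductivity.HubbardSuperconductivity.Theorems.AnisotropyChord.InsertionEntropy
open Summit.HubbardSuperconductivity.HubbardSuperconductivity.Theorems.AnisotropyChord.Stiffness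

namespace Summit.HubbardSuperconductivity.HubbardSuperconductivity.Theorems.AnisotropyChord.FerroSide

/-! ### Piece C of the range split of `FerroSideChord` -/

/-- **Closedness of the chord bound under limits in `Δ`.**  On the `M × M` torus, sector
`S^z_tot = 0`: if the chord bound `((1+Δ)/2)·S(S+1) ≤ Λ(ψ)` (`S(S+1) := (M²/2)(M²/2+1)`) holds for
every `Δ ∈ (0,1)` and every normalised sector ground state, then it holds at every `Δ₀` that has
points of `(0,1)` arbitrarily close, for every normalised sector ground state `ψ` of `H_M(Δ₀)`
(`Λ` is continuous in `Δ`, `sectorGS_lambda_continuousAt`; the chord is affine). [folklore] -/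
theorem chord_le_lambda_of_interior (M : ℕ) [NeZero M]
    (hint : ∀ Δ ∈ Set.Ioo (0:ℝ) 1, ∀ (ψ : TensorIndex (TorusSite 2 M) 2 → ℂ),
      ψ ∈ spinZSector (Λ := TorusSite 2 M) 1 0 → star ψ ⬝ᵥ ψ = 1 →
      hcbHamiltonian M Δ *ᵥ ψ = ((lowestEnergyInSector 1 (hcbHamiltonian M Δ) 0 : ℝ) : ℂ) • ψ →
      (1 + Δ) / 2 * ((M : ℝ) ^ 2 / 2 * ((M : ℝ) ^ 2 / 2 + 1)) ≤
        (star ψ ⬝ᵥ (((∑ x : TorusSite 2 M, onSite x (spinRaise 1)) *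
          (∑ y : TorusSite 2 M, onSite y (spinLower 1)) : Op (TorusSite 2 M) 2) *ᵥ ψ)).re)
    {Δ₀ : ℝ} (happ : ∀ ρ > (0 : ℝ), ∃ Δ ∈ Set.Ioo (0:ℝ) 1, |Δ - Δ₀| < ρ)
    {ψ : TensorIndex (TorusSite 2 M) 2 → ℂ} (hmem : ψ ∈ spinZSector (Λ := TorusSite 2 M) 1 0)
    (hψ1 : star ψ ⬝ᵥ ψ = 1)
    (heig : hcbHamiltonian M Δ₀ *ᵥ ψ = ((lowestEnergyInSector 1 (hcbHamiltonian M Δ₀) 0 : ℝ) : ℂ) • ψ) :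
    (1 + Δ₀) / 2 * ((M : ℝ) ^ 2 / 2 * ((M : ℝ) ^ 2 / 2 + 1)) ≤
      (star ψ ⬝ᵥ (((∑ x : TorusSite 2 M, onSite x (spinRaise 1)) *
        (∑ y : TorusSite 2 M, onSite y (spinLower 1)) : Op (TorusSite 2 M) 2) *ᵥ ψ)).re := by
  by_contra hlt
  rw [not_le] at hlt
  set Λ₀ := (star ψ ⬝ᵥ (((∑ x : TorusSite 2 M, onSite x (spinRaise 1)) *
      (∑ y : TorusSite 2 M, onSite y (spinLower 1)) : Op (TorusSite 2 M) 2) *ᵥ ψ)).re with hΛ₀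
  set S := (M : ℝ) ^ 2 / 2 * ((M : ℝ) ^ 2 / 2 + 1) with hS
  have hS0 : 0 ≤ S := by positivity
  -- the deficit `ε > 0`
  set ε := (1 + Δ₀) / 2 * S - Λ₀ with hε
  have hε0 : 0 < ε := by rw [hε]; linarith
  obtain ⟨δ, hδ, hcont⟩ := sectorGS_lambda_continuousAt M hmem hψ1 heig (ε / 2) (by linarith)
  -- an interior point `Δ ∈ (0,1)` within `min δ (ε/(S+1))` of `Δ₀`, and its Perron ground state
  obtain ⟨Δ, hΔI, hΔnear⟩ := happ (min δ (ε / (S + 1))) (lt_min hδ (by positivity))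
  have hΔδ : |Δ - Δ₀| < δ := lt_of_lt_of_le hΔnear (min_le_left _ _)
  have hΔε : |Δ - Δ₀| < ε / (S + 1) := lt_of_lt_of_le hΔnear (min_le_right _ _)
  have hK := spinZSector_ne_bot_of_unit M hmem hψ1
  obtain ⟨a, ha⟩ := exists_perronAmplitude M Δ 0 hK
  have hchord := hint Δ hΔI (toC M a) (toC_mem_of_isPerron M ha) (toC_unit_of_isPerron M ha)
    (hcb_mulVec_toC_of_isPerron M ha)
  have hnear := hcont Δ (toC M a) hΔδ (toC_mem_of_isPerron M ha) (toC_unit_of_isPerron M ha)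
    (hcb_mulVec_toC_of_isPerron M ha)
  rw [abs_lt] at hnear
  -- the chord moves by at most `|Δ - Δ₀|·S/2 < ε/2`
  have hchordmove : (1 + Δ₀) / 2 * S - ε / 2 ≤ (1 + Δ) / 2 * S := by
    have h1 : (1 + Δ₀) / 2 * S - (1 + Δ) / 2 * S = (Δ₀ - Δ) / 2 * S := by ring
    have h2 : (Δ₀ - Δ) / 2 * S ≤ |Δ - Δ₀| / 2 * S := by
      refine mul_le_mul_of_nonneg_right ?_ hS0
      have := neg_abs_le (Δ - Δ₀)
      linarith
    have h3 : |Δ - Δ₀| / 2 * S ≤ ε / (S + 1) / 2 * S :=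
      mul_le_mul_of_nonneg_right (by linarith) hS0
    have h4 : ε / (S + 1) / 2 * S ≤ ε / 2 := by
      rw [div_div, div_mul_eq_mul_div, div_le_div_iff₀ (by positivity) (by positivity)]
      nlinarith
    linarith
  linarith [hnear.2]

/-- **`FerroSideChordEndpoints` holds** (route `AnisotropyChord`, item stmt-HubbardSuperconductivity-23920,
residual C of the range split of the crux `FerroSideChord`, stmt-19089): for every even `M ≥ 4`, if the
chord bound `((1+Δ)/2)·(M²/2)(M²/2+1) ≤ Re⟨ψ, S⁺_tot S⁻_tot ψ⟩` holds for every `Δ ∈ (0,1)` and every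
normalised `S^z_tot = 0` sector ground state `ψ` of `H_M(Δ)`, then it holds at `Δ = 0` and at
`Δ = 1`: the sector ground state is the unique Perron vector, `Λ` is continuous in `Δ`
(`sectorGS_lambda_continuousAt`), the chord is affine in `Δ`, and `≤` is closed under
`Δ ↓ 0` / `Δ ↑ 1` (`chord_le_lambda_of_interior`). [folklore] -/
theorem ferroSideChordEndpoints_proof : FerroSideChordEndpoints := by
  intro M _ _hE _h4 hint Δ hΔ ψ hmem hψ1 heig
  refine chord_le_lambda_of_interior M hint ?_ hmem hψ1 heig
  intro ρ hρ
  rcases hΔ with rfl | rfl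
  · -- `Δ = 0`: the point `min (ρ/2) (1/2)`
    refine ⟨min (ρ / 2) (1 / 2), ⟨lt_min (by linarith) (by norm_num),
      lt_of_le_of_lt (min_le_right _ _) (by norm_num)⟩, ?_⟩
    rw [sub_zero, abs_of_pos (lt_min (by linarith) (by norm_num))]
    exact lt_of_le_of_lt (min_le_left _ _) (by linarith)
  · -- `Δ = 1`: the point `1 - min (ρ/2) (1/2)`
    refine ⟨1 - min (ρ / 2) (1 / 2), ⟨?_, ?_⟩, ?_⟩
    · have := min_le_right (ρ / 2) (1 / 2 : ℝ)
      linarith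
    · have := lt_min (by linarith : (0:ℝ) < ρ / 2) (by norm_num : (0:ℝ) < 1 / 2)
      linarith
    · rw [show (1 : ℝ) - min (ρ / 2) (1 / 2) - 1 = -min (ρ / 2) (1 / 2) by ring, abs_neg,
        abs_of_pos (lt_min (by linarith) (by norm_num))]
      exact lt_of_le_of_lt (min_le_left _ _) (by linarith)

end Summit.HubbardSuperconductivity.HubbardSuperconductivity.Theorems.AnisotropyChord.FerroSide

end
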